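import Summits.QuantumAdvantage.QuantumAdvantage.Theorems.ColumnBridgeA

set_option linter.dupNamespace false
set_option linter.unusedSectionVars false

/-!
# ColumnBridgeB (lens 4, g29; kernel step K6′ of the (c0) road) — THE DISPERSING BRANCH WITH PREPARED LABELS

Blocker `X = AbsorptionDial.NoPerfectPolyOdd` (item 28487); decomp-qadv lens 4, g29.  Part A's `loss_of_freeDisperse` asks the `r` cross rows
and ALL `k` label rows to be jointly free on the column pool.  After the label PREPARATION of (c0) (puncture the low-weight codewords of the
row space of `Λ`, then change the label basis by an invertible matrix — a relabelling of the same register, `H ↦ H ∘ G⁻¹`) the labels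
split as `Λ = Fin.append Λf Λv`: the `k′` rows `Λf` are jointly free with the cross rows on the pool, the `k″` rows `Λv` VANISH on the pool.
The vanishing rows never constrain column saturation: every column label lies in `V′ = {Fin.append μ′ 0}` (`|V′| = p^{k′}`), and part A's
`colSat_of_free_disperse` for the free rows alone saturates `V′`.  Feeding `LabelSurjectiveLawA.loss_of_columnSaturation` with this `V′`:

* `appendZero`, `appendZero_injective`, `Vprep` (the label targets), `card_Vprep` (`= p^{k′}`), `label_append_eq` (the column label of a pool set
  under `Fin.append Λf Λv` is `Fin.append (Λf-label) 0`);
* ★ `loss_of_freeDisperse_prepared` — registers `g ≠ g₀` `k′+k″`-forms, `g₀ = H(Λu, quadVal M b u)` with `Λ = Fin.append Λf Λv`, `Λv` vanishing on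
  the pool, (d1) for the `r + k′` cross/free-label forms, (d2′), smallness with exponent `r + k′ + 1`, the LAW C count and the class count
  `3·p^{k′+k″}·p^{k′}·((n+1)·2p^{k′+k″} + 1) < 2^r` ⟹ a losing input.

Supports stmt-QuantumAdvantage-28487 (record; the residual `X` is NOT claimed).
-/

open Finset
open Summit.QuantumAdvantage.AdviceFreeQNC0
open Summit.QuantumAdvantage.QuantumAdvantage.Theorems.InnerDegreeDial
open Summit.QuantumAdvantage.QuantumAdvantage.Theorems.BilinearCubeSum
open Summit.QuantumAdvantage.QuantumAdvantage.Theorems.QuadSaturation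
open Summit.QuantumAdvantage.QuantumAdvantage.Theorems.LabelSurjective

namespace Summit.QuantumAdvantage.QuantumAdvantage.Theorems.ColumnBridge

variable {p : ℕ} [Fact p.Prime] {n m : ℕ}

section Prepared

variable {k' k'' : ℕ}

/-- pad a free-label target with zeros on the vanishing labels -/
def appendZero (μ' : Fin k' → ZMod p) : Fin (k' + k'') → ZMod p := Fin.append μ' 0

/-- the padded target on a free label coordinate -/
theorem appendZero_apply_left (μ' : Fin k' → ZMod p) (j : Fin k') :
    appendZero (k'' := k'') μ' (Fin.castAdd k'' j) = μ' j := by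
  unfold appendZero; rw [Fin.append_left]

/-- the padded target on a vanishing label coordinate is `0` -/
theorem appendZero_apply_right (μ' : Fin k' → ZMod p) (j : Fin k'') :
    appendZero μ' (Fin.natAdd k' j) = 0 := by
  unfold appendZero; rw [Fin.append_right]; rfl

/-- padding is injective -/
theorem appendZero_injective : Function.Injective (appendZero (p := p) (k' := k') (k'' := k'')) := by
  intro a b hab
  funext j
  have := congrFun hab (Fin.castAdd k'' j)
  rwa [appendZero_apply_left, appendZero_apply_left] at this

/-- the prepared label targets `V′ = {Fin.append μ′ 0 : μ′ ∈ 𝔽_p^{k′}}` -/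
noncomputable def Vprep (p k' k'' : ℕ) [Fact p.Prime] : Finset (Fin (k' + k'') → ZMod p) :=
  univ.map ⟨appendZero (p := p) (k' := k') (k'' := k''), appendZero_injective⟩

/-- `|V′| = p^{k′}` -/
theorem card_Vprep : (Vprep p k' k'').card = p ^ k' := by
  unfold Vprep
  rw [card_map, card_univ, Fintype.card_fun, ZMod.card, Fintype.card_fin]

/-- the column label of a set `A` inside the pool under `Fin.append Λf Λv`, `Λv` vanishing on the pool, is the padded `Λf`-label -/
theorem label_append_eq (Λf : Fin k' → Fin n → ZMod p) (Λv : Fin k'' → Fin n → ZMod p) (T : Fin m ↪ Fin n)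
    (hvan : ∀ j i, Λv j (T i) = 0) (A : Finset (Fin n)) (hA : A ⊆ univ.map T) :
    (fun j => ∑ l ∈ A, Fin.append Λf Λv j l) = appendZero (fun j => ∑ l ∈ A, Λf j l) := by
  funext j
  refine Fin.addCases (fun j' => ?_) (fun j'' => ?_) j
  · rw [appendZero_apply_left]
    refine sum_congr rfl fun l _ => ?_
    rw [Fin.append_left]
  · rw [appendZero_apply_right]
    refine sum_eq_zero fun l hl => ?_
    rw [Fin.append_right]
    obtain ⟨i, -, rfl⟩ := mem_map.mp (hA hl)
    exact hvan j'' i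

/-- **K6′ — THE DISPERSING BRANCH OF (c0) WITH PREPARED LABELS.**  As `loss_of_freeDisperse`, but the labels are `Fin.append Λf Λv` with the
`k″` rows `Λv` vanishing on the column pool and joint freeness (d1) asked only of the `r` cross rows and the `k′` free label rows; the class
count carries `|V′| = p^{k′}`. -/
theorem loss_of_freeDisperse_prepared (hp5 : 5 ≤ p) (hp3 : p.Coprime 3) {r : ℕ} (c : ℕ)
    (y : Fin (n + 1) → (Fin n → Bool) → Bool) (g₀ : Fin (n + 1))
    (lam : Fin (n + 1) → Fin (k' + k'') → Fin n → ZMod p) (F : Fin (n + 1) → (Fin (k' + k'') → ZMod p) → Bool)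
    (hF : ∀ g, g ≠ g₀ → ∀ u, y g u = F g (fun j => ∑ i, if u i = true then lam g j i else 0))
    (Λf : Fin k' → Fin n → ZMod p) (Λv : Fin k'' → Fin n → ZMod p) (M : Fin n → Fin n → ZMod p) (b : Fin n → ZMod p)
    (H : (Fin (k' + k'') → ZMod p) → ZMod p → Bool)
    (hy₀ : ∀ u, y g₀ u = H (fun j => ∑ i, if u i = true then Fin.append Λf Λv j i else 0) (quadVal M b u))
    (e : Fin r ↪ Fin n) (T : Fin m ↪ Fin n) (heT : ∀ j i, e j ≠ T i) (hvan : ∀ j i, Λv j (T i) = 0) (side : Fin m → Bool)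
    (w : ℕ) (hw : w ≤ m)
    (hfree : ∀ γ : Fin (r + k') → ZMod p, γ ≠ 0 → w ≤ (univ.filter fun i : Fin m => (∑ j, γ j * Lfull M Λf e T j i) ≠ 0).card)
    (w₂ E : ℕ)
    (hdisp : (univ.filter fun xx : (Side₁ side → Bool) × (Side₁ side → Bool) =>
      (univ.filter fun j => (rowForm (Cx M T side) xx.1 - rowForm (Cx M T side) xx.2) j ≠ 0).card < w₂).card ≤ E)
    (hsmall : 3 * (p : ℝ) ^ (r + k' + 1) *
      (Real.cos (Real.pi / (p * 3)) ^ w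
        + Real.sqrt (E + 4 ^ Fintype.card (Side₁ side) * Real.cos (Real.pi / p) ^ w₂) / 2 ^ Fintype.card (Side₁ side)) < 1)
    (hcountA : (n + 1) * (p ^ (k' + k'') * 2) * (2 * p - 1) ^ m < (2 * p) ^ m)
    (hcountB : 3 * p ^ (k' + k'') * p ^ k' * ((n + 1) * (p ^ (k' + k'') * 2) + 1) < 2 ^ r) :
    ∃ u, ringWinU c y u = false := by
  classical
  refine loss_of_columnSaturation hp5 c y g₀ lam F hF (Fin.append Λf Λv) M b H hy₀ e T heT (Vprep p k' k'') ?_ ?_ hcountA ?_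
  · intro A hA
    rw [label_append_eq Λf Λv T hvan A hA]
    unfold Vprep
    exact mem_map.mpr ⟨fun j => ∑ l ∈ A, Λf j l, mem_univ _, rfl⟩
  · intro μ hμ β xt t
    obtain ⟨μ', -, rfl⟩ := mem_map.mp hμ
    obtain ⟨A, hAT, hcross, hq, hlab, hwalk⟩ :=
      colSat_of_free_disperse hp3 M b Λf e T side g₀.val w hw hfree w₂ E hdisp hsmall μ' β xt t
    refine ⟨A, hAT, hcross, hq, ?_, hwalk⟩
    rw [label_append_eq Λf Λv T hvan A hAT, hlab]
    rfl
  · rwa [card_Vprep]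

end Prepared

end Summit.QuantumAdvantage.QuantumAdvantage.Theorems.ColumnBridge
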